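import Literature.Dynamics.TransferOperators.MayerTransferOperatorBounds
import Mathlib.Analysis.Complex.Liouville
import Mathlib.Analysis.Calculus.MeanValue
import HarnessLib

/-!
# Mayer's transfer operator — existence of `L_s` on `B(D)` for `0 < Re s`, `s ≠ 1/2`

Companion file to `MayerTransferOperator.lean` (definitions) and `MayerTransferOperatorBounds.lean`
(Hurwitz estimates). We prove that for `0 < Re s`, `s ≠ 1/2` the `κ = 0` continued formula

  `(L_s f)(z) = f(0) ζ(2s, z+1) + ∑_{n ≥ 1} (z+n)^{-2s} (f(1/(z+n)) - f(0))`      (`mayerSum₀`)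

defines a bounded operator on Mayer's Banach space `B(D)` [Mayer1990, Thm. 5, eqs. (60)–(62) with
`N = 0`; ChangMayer2001, (2.8)–(2.10)], so that `mayerTransfer s` (defined in the definitions file as
"the" operator acting by this formula, junk `0` if none exists) really is Mayer's operator there:
`exists_isMayerTransferAt`, `mayerTransfer_toFun_apply_of_re_pos`.

## Contents

* `MayerSpace.norm_deriv_toFun_le`, `MayerSpace.norm_toFun_sub_toFun_zero_le` — for `f ∈ B(D)`:
  `‖f'(u)‖ ≤ 2‖f‖` on `closedBall 1 1` (Cauchy estimate on discs of radius `1/2`, which stay in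
  `D`) and the Lipschitz estimate `‖f(w) - f(0)‖ ≤ 2 ‖f‖ ‖w‖` for `w ∈ closedBall 1 1 ∋ 0`
  (mean value inequality on a convex set). The inverse branches `1/(z+n)`, `z ∈ D̄`, land in
  `closedBall 1 1`.
* `norm_mayerTerm_sub_le` — the term estimate
  `‖(z+n+1)^{-2s}(f(1/(z+n+1)) - f(0))‖ ≤ 2 e^{π|Im 2s|/2} ‖f‖ (n+1/2)^{-(2 Re s+1)}` on `D̄`,
  summable for `Re s > 0`.
* `continuousOn_mayerSum₀`, `differentiableOn_mayerSum₀` — `mayerSum₀ s f ∈ B(D)` (M-test), using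
  `continuousOn_hurwitzZetaC` / `differentiableOn_hurwitzZetaC` from the bounds file for the
  Hurwitz part (this is where `s ≠ 1/2`, i.e. `2s ≠ 1`, enters).
* `mayerTransferLM`, `exists_bound_mayerTransferLM`, `mayerTransferCLM` — linearity and the bound
  `‖L_s f‖ ≤ (M + 2 e^{π|Im 2s|/2} ∑ₙ (n+1/2)^{-(2Re s+1)}) ‖f‖`, `M = max_{D̄} |ζ(2s, z+1)|`.
* `exists_isMayerTransferAt`, `mayerTransfer_eq_mayerTransferCLM`,
  `mayerTransfer_toFun_apply_of_re_pos`.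

Nuclearity / compactness and holomorphy in `s` (the named facts `MayerTransferCompact`,
`MayerTransferHolomorphic`) are NOT addressed here.

## References

* [Mayer1990] D. Mayer, On the thermodynamic formalism for the Gauss map, CMP 130 (1990), Thm. 5,
  eqs. (58)–(62).
* [ChangMayer2001] C.-H. Chang, D. Mayer, Eigenfunctions of the transfer operators and the period
  functions for modular groups, Contemp. Math. 290 (2001) 1–40, (2.8)–(2.10).
-/

noncomputable section

open Complex Metric Set Filter Topology Real

namespace Literature.Dynamics.TransferOperators

/-! ### A Lipschitz estimate at `0` for elements of `B(D)` -/

/-- A ball of radius `1/2` around a point of `closedBall 1 1` lies in Mayer's open disc. [folklore] -/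
theorem ball_half_subset_mayerDisc {u : ℂ} (hu : u ∈ closedBall (1 : ℂ) 1) :
    ball u (1 / 2) ⊆ mayerDisc := by
  intro z hz
  rw [mem_mayerDisc]
  rw [mem_ball] at hz
  rw [mem_closedBall] at hu
  calc dist z 1 ≤ dist z u + dist u 1 := dist_triangle _ _ _
    _ < 1 / 2 + 1 := by linarith
    _ = 3 / 2 := by norm_num

/-- A closed ball of radius `1/2` around a point of `closedBall 1 1` lies in the closed disc. [folklore] -/
theorem closedBall_half_subset_mayerClosedDisc {u : ℂ} (hu : u ∈ closedBall (1 : ℂ) 1) :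
    closedBall u (1 / 2) ⊆ mayerClosedDisc := by
  intro z hz
  rw [mem_mayerClosedDisc]
  rw [mem_closedBall] at hz hu
  calc dist z 1 ≤ dist z u + dist u 1 := dist_triangle _ _ _
    _ ≤ 1 / 2 + 1 := by linarith
    _ = 3 / 2 := by norm_num

/-- **Cauchy estimate** on `closedBall 1 1`: `‖f'(u)‖ ≤ 2 ‖f‖` for `f ∈ B(D)`. [folklore] -/
theorem MayerSpace.norm_deriv_toFun_le (f : MayerSpace) {u : ℂ} (hu : u ∈ closedBall (1 : ℂ) 1) :
    ‖deriv f.toFun u‖ ≤ 2 * ‖f‖ := by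
  have hR : (0 : ℝ) < 1 / 2 := by norm_num
  have hd : DiffContOnCl ℂ f.toFun (ball u (1 / 2)) := by
    refine ⟨f.differentiableOn_toFun.mono (ball_half_subset_mayerDisc hu), ?_⟩
    rw [closure_ball u hR.ne']
    exact f.continuousOn_toFun.mono (closedBall_half_subset_mayerClosedDisc hu)
  have h := Complex.norm_deriv_le_of_forall_mem_sphere_norm_le (C := ‖f‖) hR hd fun z hz =>
    f.norm_toFun_le (closedBall_half_subset_mayerClosedDisc hu (sphere_subset_closedBall hz))
  calc ‖deriv f.toFun u‖ ≤ ‖f‖ / (1 / 2) := h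
    _ = 2 * ‖f‖ := by ring

/-- **Lipschitz estimate at `0`**: `‖f(w) - f(0)‖ ≤ 2 ‖f‖ ‖w‖` for `w ∈ closedBall 1 1`, `f ∈ B(D)`
(mean value inequality on the convex set `closedBall 1 1 ∋ 0`). [folklore] -/
theorem MayerSpace.norm_toFun_sub_toFun_zero_le (f : MayerSpace) {w : ℂ}
    (hw : w ∈ closedBall (1 : ℂ) 1) : ‖f.toFun w - f.toFun 0‖ ≤ 2 * ‖f‖ * ‖w‖ := by
  have h0 : (0 : ℂ) ∈ closedBall (1 : ℂ) 1 := by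
    rw [mem_closedBall, dist_eq_norm, zero_sub, norm_neg, norm_one]
  have hdiff : ∀ x ∈ closedBall (1 : ℂ) 1, DifferentiableAt ℂ f.toFun x := fun x hx =>
    f.differentiableOn_toFun.differentiableAt
      (isOpen_mayerDisc.mem_nhds (closedBall_one_one_subset_mayerDisc hx))
  have key := (convex_closedBall (1 : ℂ) 1).norm_image_sub_le_of_norm_deriv_le
    (f := f.toFun) (C := 2 * ‖f‖) hdiff (fun x hx => f.norm_deriv_toFun_le hx) h0 hw
  rw [sub_zero] at key
  exact key

/-! ### Estimates for the branch terms on the closed disc -/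

/-- On the closed disc, `Re (z + n + 1) ≥ n + 1/2`. [folklore] -/
theorem re_add_natCast_succ_ge {z : ℂ} (hz : z ∈ mayerClosedDisc) (n : ℕ) :
    (n : ℝ) + 1 / 2 ≤ (z + (n + 1)).re := by
  have h := re_ge_of_mem_mayerClosedDisc hz
  simp only [add_re, natCast_re, one_re]
  linarith

/-- Norm of the power factor: `‖(z+n+1)^{-2s}‖ ≤ e^{π |Im 2s|/2} (n + 1/2)^{-2 Re s}` on the closed disc,
for `Re s ≥ 0`. [folklore] -/
theorem norm_cpow_branch_le {z : ℂ} (hz : z ∈ mayerClosedDisc) (n : ℕ) {s : ℂ} (hs : 0 ≤ s.re) :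
    ‖(z + (n + 1)) ^ (-(2 * s))‖ ≤
      Real.exp (π / 2 * |(2 * s).im|) * ((n : ℝ) + 1 / 2) ^ (-(2 * s.re)) := by
  have hre : 0 < (z + (n + 1)).re := re_add_pos_of_mem_mayerClosedDisc hz n
  have hw : (-(2 * s)).re ≤ 0 := by simp; linarith
  have h1 := norm_cpow_le_re_rpow_of_re_pos hre hw
  have hexp : (-(2 * s)).re = -(2 * s.re) := by simp
  have him : |(-(2 * s)).im| = |(2 * s).im| := by rw [neg_im, abs_neg]
  rw [hexp, him] at h1
  refine h1.trans ?_
  rw [mul_comm]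
  refine mul_le_mul_of_nonneg_left ?_ (Real.exp_pos _).le
  exact Real.rpow_le_rpow_of_nonpos (by positivity) (re_add_natCast_succ_ge hz n) (by linarith)

/-- Norm of the inverse branch point: `‖1/(z+n+1)‖ ≤ (n + 1/2)⁻¹` on the closed disc. [folklore] -/
theorem norm_one_div_branch_le {z : ℂ} (hz : z ∈ mayerClosedDisc) (n : ℕ) :
    ‖1 / (z + (n + 1))‖ ≤ ((n : ℝ) + 1 / 2)⁻¹ := by
  have h1 := re_add_natCast_succ_ge hz n
  have hpos : (0 : ℝ) < (n : ℝ) + 1 / 2 := by positivity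
  have h2 : (n : ℝ) + 1 / 2 ≤ ‖z + (n + 1)‖ := h1.trans (re_le_norm _)
  rw [norm_div, norm_one, one_div]
  exact inv_anti₀ hpos h2

/-- **Term estimate** for the continued sum: on the closed disc, for `Re s ≥ 0`,
`‖(z+n+1)^{-2s} (f(1/(z+n+1)) - f(0))‖ ≤ 2 e^{π|Im 2s|/2} ‖f‖ (n + 1/2)^{-(2 Re s + 1)}`. [folklore] -/
theorem norm_mayerTerm_sub_le (f : MayerSpace) {z : ℂ} (hz : z ∈ mayerClosedDisc) {s : ℂ}
    (hs : 0 ≤ s.re) (n : ℕ) :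
    ‖mayerTerm s (fun w => f.toFun w - f.toFun 0) n z‖ ≤
      2 * Real.exp (π / 2 * |(2 * s).im|) * ‖f‖ * ((n : ℝ) + 1 / 2) ^ (-(2 * s.re + 1)) := by
  have hpos : (0 : ℝ) < (n : ℝ) + 1 / 2 := by positivity
  have hw : 1 / (z + (n + 1)) ∈ closedBall (1 : ℂ) 1 :=
    one_div_mem_closedBall_one_one (by
      have := re_add_natCast_succ_ge hz n
      have hn : (0 : ℝ) ≤ n := n.cast_nonneg
      linarith)
  have h1 := norm_cpow_branch_le hz n hs
  have h2 : ‖f.toFun (1 / (z + (n + 1))) - f.toFun 0‖ ≤ 2 * ‖f‖ * ((n : ℝ) + 1 / 2)⁻¹ :=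
    (f.norm_toFun_sub_toFun_zero_le hw).trans
      (mul_le_mul_of_nonneg_left (norm_one_div_branch_le hz n) (by positivity))
  have hsplit : ((n : ℝ) + 1 / 2) ^ (-(2 * s.re + 1)) =
      ((n : ℝ) + 1 / 2) ^ (-(2 * s.re)) * ((n : ℝ) + 1 / 2)⁻¹ := by
    rw [show -(2 * s.re + 1) = -(2 * s.re) + (-1) by ring, Real.rpow_add hpos, Real.rpow_neg_one]
  unfold mayerTerm
  rw [norm_mul, hsplit]
  calc ‖(z + (n + 1)) ^ (-(2 * s))‖ * ‖f.toFun (1 / (z + (n + 1))) - f.toFun 0‖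
      ≤ (Real.exp (π / 2 * |(2 * s).im|) * ((n : ℝ) + 1 / 2) ^ (-(2 * s.re))) *
          (2 * ‖f‖ * ((n : ℝ) + 1 / 2)⁻¹) :=
        mul_le_mul h1 h2 (norm_nonneg _) (by positivity)
    _ = 2 * Real.exp (π / 2 * |(2 * s).im|) * ‖f‖ *
          (((n : ℝ) + 1 / 2) ^ (-(2 * s.re)) * ((n : ℝ) + 1 / 2)⁻¹) := by ring

/-- The comparison series for the continued sum converges when `Re s > 0`. [folklore] -/
theorem summable_mayerTerm_bound {s : ℂ} (hs : 0 < s.re) (C : ℝ) :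
    Summable fun n : ℕ => C * ((n : ℝ) + 1 / 2) ^ (-(2 * s.re + 1)) :=
  (summable_nat_add_rpow_neg (by norm_num : (0 : ℝ) < 1 / 2) (by linarith : 0 < 2 * s.re)).mul_left C

/-- The continued sum converges absolutely at every point of the closed disc (`Re s > 0`). [folklore] -/
theorem summable_mayerTerm_sub (f : MayerSpace) {z : ℂ} (hz : z ∈ mayerClosedDisc) {s : ℂ}
    (hs : 0 < s.re) : Summable fun n => mayerTerm s (fun w => f.toFun w - f.toFun 0) n z :=
  Summable.of_norm_bounded (summable_mayerTerm_bound hs _) fun n => norm_mayerTerm_sub_le f hz hs.le n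

/-! ### Regularity of the terms and of the sum -/

/-- The inverse branch `z ↦ 1/(z+n+1)` is holomorphic off `z = -(n+1)`, in particular on the
half-plane `Re z > -1`. [folklore] -/
theorem differentiableOn_one_div_branch (n : ℕ) :
    DifferentiableOn ℂ (fun z : ℂ => 1 / (z + (n + 1))) {z : ℂ | -1 < z.re} := by
  refine DifferentiableOn.div (differentiableOn_const _) (differentiableOn_id.add_const _) ?_
  intro z hz h0
  have hz' : (-1 : ℝ) < z.re := hz
  have := congrArg Complex.re h0
  simp only [add_re, natCast_re, one_re, zero_re] at this
  have hn : (0 : ℝ) ≤ n := n.cast_nonneg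
  linarith

/-- The closed disc lies in the half-plane `Re z > -1`. [folklore] -/
theorem mayerClosedDisc_subset_halfPlane : mayerClosedDisc ⊆ {z : ℂ | -1 < z.re} := fun z hz => by
  have h := re_ge_of_mem_mayerClosedDisc hz
  show (-1 : ℝ) < z.re
  linarith

/-- The power factor `z ↦ (z+n+1)^{-2s}` is holomorphic on the half-plane `Re z > -1`. [folklore] -/
theorem differentiableOn_cpow_branch (s : ℂ) (n : ℕ) :
    DifferentiableOn ℂ (fun z : ℂ => (z + (n + 1)) ^ (-(2 * s))) {z : ℂ | -1 < z.re} := by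
  refine (differentiableOn_id.add_const _).cpow_const ?_
  intro z hz
  have hz' : (-1 : ℝ) < z.re := hz
  refine mem_slitPlane_iff.mpr (Or.inl ?_)
  simp only [id_eq, add_re, natCast_re, one_re]
  have hn : (0 : ℝ) ≤ n := n.cast_nonneg
  linarith

/-- Each term of the continued sum is holomorphic on Mayer's open disc. [folklore] -/
theorem differentiableOn_mayerTerm_sub (s : ℂ) (f : MayerSpace) (n : ℕ) :
    DifferentiableOn ℂ (mayerTerm s (fun w => f.toFun w - f.toFun 0) n) mayerDisc := by
  have hsub : mayerDisc ⊆ {z : ℂ | -1 < z.re} :=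
    mayerDisc_subset_mayerClosedDisc.trans mayerClosedDisc_subset_halfPlane
  have h1 := (differentiableOn_cpow_branch s n).mono hsub
  have h2 : DifferentiableOn ℂ (fun z => f.toFun (1 / (z + (n + 1)))) mayerDisc :=
    f.differentiableOn_toFun.comp ((differentiableOn_one_div_branch n).mono hsub)
      fun z hz => one_div_add_mem_mayerDisc (mayerDisc_subset_mayerClosedDisc hz) n
  unfold mayerTerm
  exact h1.mul (h2.sub_const _)

/-- Each term of the continued sum is continuous on the closed disc. [folklore] -/
theorem continuousOn_mayerTerm_sub (s : ℂ) (f : MayerSpace) (n : ℕ) :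
    ContinuousOn (mayerTerm s (fun w => f.toFun w - f.toFun 0) n) mayerClosedDisc := by
  have h1 := ((differentiableOn_cpow_branch s n).continuousOn).mono mayerClosedDisc_subset_halfPlane
  have h2 : ContinuousOn (fun z => f.toFun (1 / (z + (n + 1)))) mayerClosedDisc :=
    f.differentiableOn_toFun.continuousOn.comp
      (((differentiableOn_one_div_branch n).continuousOn).mono mayerClosedDisc_subset_halfPlane)
      fun z hz => one_div_add_mem_mayerDisc hz n
  unfold mayerTerm
  exact h1.mul (h2.sub continuousOn_const)

/-- The continued sum is continuous on the closed disc (`Re s > 0`). [folklore] -/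
theorem continuousOn_tsum_mayerTerm_sub {s : ℂ} (hs : 0 < s.re) (f : MayerSpace) :
    ContinuousOn (fun z => ∑' n, mayerTerm s (fun w => f.toFun w - f.toFun 0) n z)
      mayerClosedDisc :=
  continuousOn_tsum (continuousOn_mayerTerm_sub s f) (summable_mayerTerm_bound hs _)
    fun n _ hz => norm_mayerTerm_sub_le f hz hs.le n

/-- The continued sum is holomorphic on the open disc (`Re s > 0`; Weierstrass M-test). [folklore] -/
theorem differentiableOn_tsum_mayerTerm_sub {s : ℂ} (hs : 0 < s.re) (f : MayerSpace) :
    DifferentiableOn ℂ (fun z => ∑' n, mayerTerm s (fun w => f.toFun w - f.toFun 0) n z)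
      mayerDisc :=
  Complex.differentiableOn_tsum_of_summable_norm (summable_mayerTerm_bound hs _)
    (differentiableOn_mayerTerm_sub s f) isOpen_mayerDisc
    fun n _ hz => norm_mayerTerm_sub_le f (mayerDisc_subset_mayerClosedDisc hz) hs.le n

/-- The closed disc, shifted by one, lies in the right half-plane. [folklore] -/
theorem add_one_re_pos_of_mem_mayerClosedDisc {z : ℂ} (hz : z ∈ mayerClosedDisc) : 0 < (z + 1).re := by
  have h := re_ge_of_mem_mayerClosedDisc hz
  simp only [add_re, one_re]
  linarith

/-- The Hurwitz part `z ↦ ζ(2s, z+1)` is continuous on the closed disc (`0 < Re s`, `s ≠ 1/2`). [folklore] -/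
theorem continuousOn_hurwitzZetaC_add_one {s : ℂ} (hs : 0 < s.re) (hs' : s ≠ 1 / 2) :
    ContinuousOn (fun z => hurwitzZetaC (2 * s) (z + 1)) mayerClosedDisc := by
  have h2s : 2 * s ≠ 1 := fun h => hs' (by linear_combination h / 2)
  have h2σ : 0 < (2 * s).re := by simp; linarith
  exact (continuousOn_hurwitzZetaC h2s h2σ).comp (continuousOn_id.add continuousOn_const)
    fun z hz => add_one_re_pos_of_mem_mayerClosedDisc hz

/-- The Hurwitz part `z ↦ ζ(2s, z+1)` is holomorphic on the open disc (`0 < Re s`, `s ≠ 1/2`). [folklore] -/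
theorem differentiableOn_hurwitzZetaC_add_one {s : ℂ} (hs : 0 < s.re) (hs' : s ≠ 1 / 2) :
    DifferentiableOn ℂ (fun z => hurwitzZetaC (2 * s) (z + 1)) mayerDisc := by
  have h2s : 2 * s ≠ 1 := fun h => hs' (by linear_combination h / 2)
  have h2σ : 0 < (2 * s).re := by simp; linarith
  exact (differentiableOn_hurwitzZetaC h2s h2σ).comp (differentiableOn_id.add_const _)
    fun z hz => add_one_re_pos_of_mem_mayerClosedDisc (mayerDisc_subset_mayerClosedDisc hz)

/-- **`mayerSum₀ s f` is continuous on the closed disc** for `f ∈ B(D)`, `0 < Re s`, `s ≠ 1/2`. [folklore] -/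
theorem continuousOn_mayerSum₀ {s : ℂ} (hs : 0 < s.re) (hs' : s ≠ 1 / 2) (f : MayerSpace) :
    ContinuousOn (mayerSum₀ s f.toFun) mayerClosedDisc :=
  (continuousOn_const.mul (continuousOn_hurwitzZetaC_add_one hs hs')).add
    (continuousOn_tsum_mayerTerm_sub hs f)

/-- **`mayerSum₀ s f` is holomorphic on the open disc** for `f ∈ B(D)`, `0 < Re s`, `s ≠ 1/2`. [folklore] -/
theorem differentiableOn_mayerSum₀ {s : ℂ} (hs : 0 < s.re) (hs' : s ≠ 1 / 2) (f : MayerSpace) :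
    DifferentiableOn ℂ (mayerSum₀ s f.toFun) mayerDisc :=
  ((differentiableOn_const _).mul (differentiableOn_hurwitzZetaC_add_one hs hs')).add
    (differentiableOn_tsum_mayerTerm_sub hs f)

/-! ### The operator -/

/-- The image `L_s f ∈ B(D)` of `f ∈ B(D)`: the function `mayerSum₀ s f` on the closed disc
(`0 < Re s`, `s ≠ 1/2`). [cite: Mayer1990, Thm. 5, eqs. (60)–(62)] -/
def mayerTransferFun {s : ℂ} (hs : 0 < s.re) (hs' : s ≠ 1 / 2) (f : MayerSpace) : MayerSpace :=
  MayerSpace.mk (mayerSum₀ s f.toFun) (continuousOn_mayerSum₀ hs hs' f) (differentiableOn_mayerSum₀ hs hs' f)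

/-- Point values of `L_s f`. [folklore] -/
theorem mayerTransferFun_toFun_apply {s : ℂ} (hs : 0 < s.re) (hs' : s ≠ 1 / 2) (f : MayerSpace) {z : ℂ}
    (hz : z ∈ mayerClosedDisc) : (mayerTransferFun hs hs' f).toFun z = mayerSum₀ s f.toFun z :=
  MayerSpace.mk_toFun_apply _ _ _ hz

/-- The terms are additive in `f`. [folklore] -/
theorem mayerTerm_sub_add (s : ℂ) (f g : MayerSpace) (n : ℕ) (z : ℂ) :
    mayerTerm s (fun w => (f + g).toFun w - (f + g).toFun 0) n z =
      mayerTerm s (fun w => f.toFun w - f.toFun 0) n z + mayerTerm s (fun w => g.toFun w - g.toFun 0) n z := by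
  simp only [mayerTerm, MayerSpace.toFun_add, Pi.add_apply]
  ring

/-- The terms are homogeneous in `f`. [folklore] -/
theorem mayerTerm_sub_smul (s c : ℂ) (f : MayerSpace) (n : ℕ) (z : ℂ) :
    mayerTerm s (fun w => (c • f).toFun w - (c • f).toFun 0) n z =
      c * mayerTerm s (fun w => f.toFun w - f.toFun 0) n z := by
  simp only [mayerTerm, MayerSpace.toFun_smul, Pi.smul_apply, smul_eq_mul]
  ring

/-- `mayerSum₀ s` is additive on `B(D)` at points of the closed disc (`Re s > 0`). [folklore] -/
theorem mayerSum₀_add {s : ℂ} (hs : 0 < s.re) (f g : MayerSpace) {z : ℂ} (hz : z ∈ mayerClosedDisc) :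
    mayerSum₀ s (f + g).toFun z = mayerSum₀ s f.toFun z + mayerSum₀ s g.toFun z := by
  simp only [mayerSum₀]
  rw [show (fun n => mayerTerm s (fun w => (f + g).toFun w - (f + g).toFun 0) n z) =
      fun n => mayerTerm s (fun w => f.toFun w - f.toFun 0) n z +
        mayerTerm s (fun w => g.toFun w - g.toFun 0) n z from funext fun n => mayerTerm_sub_add s f g n z,
    (summable_mayerTerm_sub f hz hs).tsum_add (summable_mayerTerm_sub g hz hs)]
  simp only [MayerSpace.toFun_add, Pi.add_apply]
  ring

/-- `mayerSum₀ s` is homogeneous on `B(D)`. [folklore] -/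
theorem mayerSum₀_smul (s c : ℂ) (f : MayerSpace) (z : ℂ) :
    mayerSum₀ s (c • f).toFun z = c * mayerSum₀ s f.toFun z := by
  simp only [mayerSum₀]
  rw [show (fun n => mayerTerm s (fun w => (c • f).toFun w - (c • f).toFun 0) n z) =
      fun n => c * mayerTerm s (fun w => f.toFun w - f.toFun 0) n z from
      funext fun n => mayerTerm_sub_smul s c f n z, tsum_mul_left]
  simp only [MayerSpace.toFun_smul, Pi.smul_apply, smul_eq_mul]
  ring

/-- `L_s` as a linear map on `B(D)` (`0 < Re s`, `s ≠ 1/2`). [folklore] -/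
def mayerTransferLM {s : ℂ} (hs : 0 < s.re) (hs' : s ≠ 1 / 2) : MayerSpace →ₗ[ℂ] MayerSpace where
  toFun := mayerTransferFun hs hs'
  map_add' f g := MayerSpace.ext fun z hz => by
    rw [MayerSpace.toFun_add, Pi.add_apply, mayerTransferFun_toFun_apply hs hs' _ hz,
      mayerTransferFun_toFun_apply hs hs' _ hz, mayerTransferFun_toFun_apply hs hs' _ hz]
    exact mayerSum₀_add hs f g hz
  map_smul' c f := MayerSpace.ext fun z hz => by
    rw [MayerSpace.toFun_smul, Pi.smul_apply, mayerTransferFun_toFun_apply hs hs' _ hz,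
      mayerTransferFun_toFun_apply hs hs' _ hz, RingHom.id_apply, smul_eq_mul]
    exact mayerSum₀_smul s c f z

/-- **Pointwise bound** for `mayerSum₀ s f` on the closed disc: with `M` a bound for
`‖ζ(2s, z+1)‖` on the closed disc,
`‖(L_s f)(z)‖ ≤ (M + 2 e^{π|Im 2s|/2} ∑ₙ (n+1/2)^{-(2 Re s+1)}) ‖f‖`. [folklore] -/
theorem norm_mayerSum₀_le {s : ℂ} (hs : 0 < s.re) (f : MayerSpace) {z : ℂ} (hz : z ∈ mayerClosedDisc)
    {M : ℝ} (hM : ‖hurwitzZetaC (2 * s) (z + 1)‖ ≤ M) :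
    ‖mayerSum₀ s f.toFun z‖ ≤
      (M + 2 * Real.exp (π / 2 * |(2 * s).im|) *
        ∑' n : ℕ, ((n : ℝ) + 1 / 2) ^ (-(2 * s.re + 1))) * ‖f‖ := by
  have h1 : ‖f.toFun 0 * hurwitzZetaC (2 * s) (z + 1)‖ ≤ M * ‖f‖ := by
    rw [norm_mul, mul_comm]
    exact mul_le_mul hM (f.norm_toFun_le zero_mem_mayerClosedDisc) (norm_nonneg _)
      ((norm_nonneg _).trans hM)
  have h2 : ‖∑' n : ℕ, mayerTerm s (fun w => f.toFun w - f.toFun 0) n z‖ ≤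
      ∑' n : ℕ, 2 * Real.exp (π / 2 * |(2 * s).im|) * ‖f‖ * ((n : ℝ) + 1 / 2) ^ (-(2 * s.re + 1)) :=
    tsum_of_norm_bounded (summable_mayerTerm_bound hs _).hasSum
      fun n => norm_mayerTerm_sub_le f hz hs.le n
  rw [tsum_mul_left] at h2
  calc ‖mayerSum₀ s f.toFun z‖
      ≤ ‖f.toFun 0 * hurwitzZetaC (2 * s) (z + 1)‖ +
          ‖∑' n : ℕ, mayerTerm s (fun w => f.toFun w - f.toFun 0) n z‖ := norm_add_le _ _
    _ ≤ M * ‖f‖ + 2 * Real.exp (π / 2 * |(2 * s).im|) * ‖f‖ *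
          ∑' n : ℕ, ((n : ℝ) + 1 / 2) ^ (-(2 * s.re + 1)) := add_le_add h1 h2
    _ = (M + 2 * Real.exp (π / 2 * |(2 * s).im|) *
          ∑' n : ℕ, ((n : ℝ) + 1 / 2) ^ (-(2 * s.re + 1))) * ‖f‖ := by ring

/-- **`L_s` is bounded on `B(D)`** (`0 < Re s`, `s ≠ 1/2`). [cite: Mayer1990, Thm. 5] -/
theorem exists_bound_mayerTransferLM {s : ℂ} (hs : 0 < s.re) (hs' : s ≠ 1 / 2) :
    ∃ C, ∀ f : MayerSpace, ‖mayerTransferLM hs hs' f‖ ≤ C * ‖f‖ := by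
  obtain ⟨M, hM⟩ := isCompact_mayerClosedDisc.exists_bound_of_continuousOn
    (continuousOn_hurwitzZetaC_add_one hs hs')
  set Z : ℝ := ∑' n : ℕ, ((n : ℝ) + 1 / 2) ^ (-(2 * s.re + 1)) with hZ
  have hM0 : 0 ≤ M := (norm_nonneg _).trans (hM 0 zero_mem_mayerClosedDisc)
  have hZ0 : 0 ≤ Z := tsum_nonneg fun n => Real.rpow_nonneg (by positivity) _
  refine ⟨M + 2 * Real.exp (π / 2 * |(2 * s).im|) * Z, fun f => ?_⟩
  refine MayerSpace.norm_le_of_forall_le _ (by positivity) fun z hz => ?_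
  change ‖(mayerTransferFun hs hs' f).toFun z‖ ≤ _
  rw [mayerTransferFun_toFun_apply hs hs' f hz]
  exact norm_mayerSum₀_le hs f hz (hM z hz)

/-- **Mayer's transfer operator as a bounded operator on `B(D)`**, for `0 < Re s`, `s ≠ 1/2`:
the operator acting by the `κ = 0` continued formula `mayerSum₀`. [cite: Mayer1990, Thm. 5] -/
def mayerTransferCLM {s : ℂ} (hs : 0 < s.re) (hs' : s ≠ 1 / 2) : MayerSpace →L[ℂ] MayerSpace :=
  (mayerTransferLM hs hs').mkContinuousOfExistsBound (exists_bound_mayerTransferLM hs hs')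

/-- `mayerTransferCLM` acts by Mayer's continued formula. [folklore] -/
theorem isMayerTransferAt_mayerTransferCLM {s : ℂ} (hs : 0 < s.re) (hs' : s ≠ 1 / 2) :
    IsMayerTransferAt s (mayerTransferCLM hs hs') := fun f z =>
  mayerTransferFun_toFun_apply hs hs' f z.2

/-- **Existence of Mayer's transfer operator on `B(D)`** for `0 < Re s`, `s ≠ 1/2`: some (hence a
unique) bounded operator on `B(D)` acts by the continued formula
`(L_s f)(z) = f(0) ζ(2s, z+1) + ∑_{n ≥ 1} (z+n)^{-2s} (f(1/(z+n)) - f(0))`.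
[cite: Mayer1990, Thm. 5, eqs. (60)–(62)] -/
theorem exists_isMayerTransferAt {s : ℂ} (hs : 0 < s.re) (hs' : s ≠ 1 / 2) :
    ∃ T, IsMayerTransferAt s T :=
  ⟨mayerTransferCLM hs hs', isMayerTransferAt_mayerTransferCLM hs hs'⟩

/-- `mayerTransfer s = mayerTransferCLM` in the range `0 < Re s`, `s ≠ 1/2`. [folklore] -/
theorem mayerTransfer_eq_mayerTransferCLM {s : ℂ} (hs : 0 < s.re) (hs' : s ≠ 1 / 2) :
    mayerTransfer s = mayerTransferCLM hs hs' :=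
  mayerTransfer_eq (isMayerTransferAt_mayerTransferCLM hs hs')

/-- **Pointwise action of `L_s`** in the range `0 < Re s`, `s ≠ 1/2` (unconditional form of
`mayerTransfer_toFun_apply`). [cite: Mayer1990, Thm. 5, eqs. (60)–(62)] -/
theorem mayerTransfer_toFun_apply_of_re_pos {s : ℂ} (hs : 0 < s.re) (hs' : s ≠ 1 / 2)
    (f : MayerSpace) (z : mayerClosedDisc) :
    (mayerTransfer s f).toFun z = mayerSum₀ s f.toFun z :=
  mayerTransfer_toFun_apply (exists_isMayerTransferAt hs hs') f z

end Literature.Dynamics.TransferOperators
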